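import Summits.KontsevichZagierPeriods.KontsevichZagierPeriods.Theses.LiouvilleUnfolding
import Literature.NumberTheory.Transcendental.SemialgebraicMapsProofs

/-!
# `CatalanTwoWays` (stmt-KontsevichZagierPeriods-2839) — Catalan's constant two ways, by ONE move

Support item of route `LiouvilleUnfolding` (calibration): the two classical double-integral
representations of Catalan's constant `G = 0.91596…`,

* `A = [(0,1)², 1/(1+x²y²)]` (`∫₀¹ arctan y / y dy`), and
* `B = [(0,1)², 1/(2√((1−y²)(1−x²y²)))]` (`∫₀¹ arcsin y /(2y√(1−y²)) dy = ½∫₀^{π/2} θ/sin θ dθ`),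

are equivalent in the Kontsevich–Zagier calculus `KZ.relations`. The planner's paper proof is a
chain of four changes of variables (`(x,y) ↦ (xy,y)` on both sides, the half-angle substitutions
`y = 2t/(1+t²)` and, fibrewise, `s = 2u/(1+u²)`); composed, they are ONE rational change of
variables of the open unit square onto itself,

`Ψ(x,y) = ( x(1+y²)/(1+x²y²) , 2y/(1+y²) )`  (so that `Ψ₀Ψ₁ = 2xy/(1+x²y²)`),

with upper-triangular Jacobian of determinant `2(1−x²y²)(1−y²)/((1+x²y²)²(1+y²)) > 0`, inverse
given by half-angles of arcsines (`t = s/(1+√(1−s²))` solves `2t/(1+t²) = s`), and pull-back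
identity `1/(1+x²y²) = B.integrand (Ψ(x,y)) · det DΨ(x,y)` (the radicand `(1−Y²)(1−X²Y²)` at
`(X,Y) = Ψ(x,y)` is the square of the rational function `(1−y²)(1−x²y²)/((1+y²)(1+x²y²))`). Hence
`[A] − [B]` is a single element of `KZ.changeOfVariablesRel` (Kontsevich–Zagier's rule (2)); no
intermediate representation, no integrability estimate and no transcendental function is needed.

Contents: scalar facts on the open square (`maps_aux`, `inj_aux`, `half_angle_inv`, `surj_aux`,
`jacobian_identity`), the derivative of `Ψ` (`hasFDerivAt_psi`, `det_psiDeriv`), its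
`ℚ`-semialgebraicity (`isSemialgebraicMapOn_psi`), and the item `CatalanTwoWays_proof`.

Sources: M. Kontsevich, D. Zagier, *Periods* (2001), §1.1 (examples), §1.2 rule (2).
Design: no new definitions (the map and its Jacobian are written out in each statement).
-/

noncomputable section

open Set MeasureTheory MvPolynomial
open Literature.NumberTheory.Transcendental
open Literature.ModelTheory.ExponentialFields (IsSemialgebraic)

namespace Summit.KontsevichZagierPeriods.LiouvilleUnfolding.Catalan

/-! ## Scalar facts on the open unit square -/

/-- `Ψ` maps the open unit square into itself: `0 < x(1+y²)/(1+x²y²) < 1` and `0 < 2y/(1+y²) < 1`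
for `0 < x, y < 1`. [folklore] -/
theorem maps_aux {x y : ℝ} (hx : 0 < x) (hx1 : x < 1) (hy : 0 < y) (hy1 : y < 1) :
    0 < x * (1 + y ^ 2) / (1 + x ^ 2 * y ^ 2) ∧ x * (1 + y ^ 2) / (1 + x ^ 2 * y ^ 2) < 1 ∧
      0 < 2 * y / (1 + y ^ 2) ∧ 2 * y / (1 + y ^ 2) < 1 := by
  refine ⟨by positivity, ?_, by positivity, ?_⟩
  · rw [div_lt_one (by positivity)]
    have hy2 : y ^ 2 < 1 := by nlinarith
    have hxy2 : x * y ^ 2 < 1 := by nlinarith [mul_pos hx (sub_pos.mpr hy2)]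
    nlinarith [mul_pos (sub_pos.mpr hx1) (sub_pos.mpr hxy2)]
  · rw [div_lt_one (by positivity)]
    nlinarith [pow_pos (sub_pos.mpr hy1) 2]

/-- `Ψ` is injective on the open unit square: `2y/(1+y²)` determines `y ∈ (0,1)`
(`(y−y')(1−yy') = 0`), and then `x(1+y²)/(1+x²y²)` determines `x ∈ (0,1)`
(`(x−x')(1−xx'y²) = 0`). [folklore] -/
theorem inj_aux {x y x' y' : ℝ} (hx : 0 < x) (hx1 : x < 1) (hy : 0 < y) (hy1 : y < 1)
    (hx' : 0 < x') (hx1' : x' < 1) (hy1' : y' < 1)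
    (h0 : x * (1 + y ^ 2) / (1 + x ^ 2 * y ^ 2) = x' * (1 + y' ^ 2) / (1 + x' ^ 2 * y' ^ 2))
    (h1 : 2 * y / (1 + y ^ 2) = 2 * y' / (1 + y' ^ 2)) : x = x' ∧ y = y' := by
  rw [div_eq_div_iff (by positivity) (by positivity)] at h1
  have e1 : (y - y') * (1 - y * y') = 0 := by linear_combination h1 / 2
  have hyy : y = y' := by
    rcases mul_eq_zero.mp e1 with h | h
    · linarith
    · have := mul_lt_one_of_nonneg_of_lt_one_left hy.le hy1 hy1'.le
      linarith
  subst hyy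
  refine ⟨?_, rfl⟩
  rw [div_eq_div_iff (by positivity) (by positivity)] at h0
  have e0 : (x - x') * ((1 - x * x' * y ^ 2) * (1 + y ^ 2)) = 0 := by linear_combination h0
  rcases mul_eq_zero.mp e0 with h | h
  · linarith
  · exfalso
    have hy2 : y ^ 2 ≤ 1 := by nlinarith
    have hxx : x * x' * y ^ 2 < 1 :=
      mul_lt_one_of_nonneg_of_lt_one_left (mul_nonneg hx.le hx'.le)
        (mul_lt_one_of_nonneg_of_lt_one_left hx.le hx1 hx1'.le) hy2
    have := mul_pos (sub_pos.mpr hxx) (show (0 : ℝ) < 1 + y ^ 2 by positivity)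
    linarith

/-- **Half-angle of an arcsine, algebraically.** For `0 < s < 1`, `t := s/(1+√(1−s²))` lies in
`(0,1)` and solves `2t/(1+t²) = s`. [folklore] -/
theorem half_angle_inv {s : ℝ} (hs0 : 0 < s) (hs1 : s < 1) :
    0 < s / (1 + √(1 - s ^ 2)) ∧ s / (1 + √(1 - s ^ 2)) < 1 ∧
      2 * (s / (1 + √(1 - s ^ 2))) / (1 + (s / (1 + √(1 - s ^ 2))) ^ 2) = s := by
  set c := √(1 - s ^ 2) with hc
  have hs2 : 0 < 1 - s ^ 2 := by nlinarith
  have hc0 : 0 < c := Real.sqrt_pos.mpr hs2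
  have hcc : c ^ 2 = 1 - s ^ 2 := Real.sq_sqrt hs2.le
  have hd : (0 : ℝ) < 1 + c := by linarith
  refine ⟨div_pos hs0 hd, (div_lt_one hd).mpr (by linarith), ?_⟩
  have key : (1 + c) * (1 + (s / (1 + c)) ^ 2) = 2 := by
    field_simp
    linear_combination hcc
  have hne : 1 + (s / (1 + c)) ^ 2 ≠ 0 := by positivity
  rw [div_eq_iff hne]
  have h2 : s * (1 + (s / (1 + c)) ^ 2) = 2 * s / (1 + c) := by
    rw [eq_div_iff hd.ne']
    linear_combination s * key
  rw [h2]
  ring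

/-- `Ψ` maps the open unit square ONTO itself: given `0 < X, Y < 1`, the half-angles
`y = Y/(1+√(1−Y²))` and `u = xy = XY/(1+√(1−(XY)²)) < y` invert it. [folklore] -/
theorem surj_aux {X Y : ℝ} (hX : 0 < X) (hX1 : X < 1) (hY : 0 < Y) (hY1 : Y < 1) :
    ∃ x y : ℝ, 0 < x ∧ x < 1 ∧ 0 < y ∧ y < 1 ∧
      x * (1 + y ^ 2) / (1 + x ^ 2 * y ^ 2) = X ∧ 2 * y / (1 + y ^ 2) = Y := by
  have hW0 : 0 < X * Y := mul_pos hX hY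
  have hWY : X * Y < Y := mul_lt_of_lt_one_left hY hX1
  have hW1 : X * Y < 1 := hWY.trans hY1
  obtain ⟨hy0, hy1, hy⟩ := half_angle_inv hY hY1
  obtain ⟨hu0, hu1, hu⟩ := half_angle_inv hW0 hW1
  set y := Y / (1 + √(1 - Y ^ 2)) with hy_def
  set u := X * Y / (1 + √(1 - (X * Y) ^ 2)) with hu_def
  have huy : u < y := by
    have hsq : √(1 - Y ^ 2) < √(1 - (X * Y) ^ 2) :=
      Real.sqrt_lt_sqrt (by nlinarith)
        (by nlinarith [mul_pos (sub_pos.mpr hWY) hW0, mul_pos (sub_pos.mpr hWY) hY])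
    have hc : (0 : ℝ) < 1 + √(1 - Y ^ 2) := by positivity
    rw [hy_def, hu_def]
    calc X * Y / (1 + √(1 - (X * Y) ^ 2)) < Y / (1 + √(1 - (X * Y) ^ 2)) :=
          div_lt_div_of_pos_right hWY (by positivity)
      _ < Y / (1 + √(1 - Y ^ 2)) := div_lt_div_of_pos_left hY hc (by linarith)
  refine ⟨u / y, y, div_pos hu0 hy0, (div_lt_one hy0).mpr huy, hy0, hy1, ?_, hy⟩
  have hy0' : y ≠ 0 := hy0.ne'
  have e1 : (u / y) ^ 2 * y ^ 2 = u ^ 2 := by field_simp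
  rw [e1]
  have hu' : 2 * u = X * Y * (1 + u ^ 2) := (div_eq_iff (by positivity)).mp hu
  have hy' : 2 * y = Y * (1 + y ^ 2) := (div_eq_iff (by positivity)).mp hy
  rw [div_eq_iff (by positivity), div_mul_eq_mul_div, div_eq_iff hy0']
  apply mul_right_cancel₀ hY.ne'
  linear_combination y * hu' - u * hy'

/-- Elementary positivity facts on the open unit square. [folklore] -/
theorem sq_facts {x y : ℝ} (hx : 0 < x) (hx1 : x < 1) (hy : 0 < y) (hy1 : y < 1) :
    0 < 1 - y ^ 2 ∧ 0 < 1 - x ^ 2 * y ^ 2 := by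
  have hy2 : y ^ 2 < 1 := by nlinarith
  refine ⟨by linarith, ?_⟩
  nlinarith [mul_pos (pow_pos hx 2) (sub_pos.mpr hy2), mul_pos hx (sub_pos.mpr hx1)]

/-- **The pull-back identity.** At `(X,Y) = Ψ(x,y)` the radicand `(1−Y²)(1−X²Y²)` of `B`'s
integrand is the square of `q = (1−y²)(1−x²y²)/((1+y²)(1+x²y²)) > 0`, and
`1/(1+x²y²) = 1/(2q) · det DΨ(x,y)`. [folklore] -/
theorem jacobian_identity {x y : ℝ} (hx : 0 < x) (hx1 : x < 1) (hy : 0 < y) (hy1 : y < 1) :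
    1 / (1 + x ^ 2 * y ^ 2) =
      1 / (2 * Real.sqrt ((1 - (2 * y / (1 + y ^ 2)) ^ 2) *
        (1 - (x * (1 + y ^ 2) / (1 + x ^ 2 * y ^ 2)) ^ 2 * (2 * y / (1 + y ^ 2)) ^ 2))) *
      |(1 + y ^ 2) * (1 - x ^ 2 * y ^ 2) / (1 + x ^ 2 * y ^ 2) ^ 2 *
        (2 * (1 - y ^ 2) / (1 + y ^ 2) ^ 2) - 2 * x * y * (1 - x ^ 2) / (1 + x ^ 2 * y ^ 2) ^ 2 * 0| := by
  obtain ⟨h1, h2⟩ := sq_facts hx hx1 hy hy1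
  have h4 : (0 : ℝ) < 1 + x ^ 2 * y ^ 2 := by positivity
  have h5 : (0 : ℝ) < 1 + y ^ 2 := by positivity
  have h1' := h1.ne'
  have h2' := h2.ne'
  have h4' := h4.ne'
  have h5' := h5.ne'
  obtain ⟨q, hq⟩ : ∃ q : ℝ, q = (1 - y ^ 2) * (1 - x ^ 2 * y ^ 2) / ((1 + y ^ 2) * (1 + x ^ 2 * y ^ 2)) :=
    ⟨_, rfl⟩
  have hq0 : 0 < q := by rw [hq]; exact div_pos (mul_pos h1 h2) (mul_pos h5 h4)
  have hR : (1 - (2 * y / (1 + y ^ 2)) ^ 2) *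
      (1 - (x * (1 + y ^ 2) / (1 + x ^ 2 * y ^ 2)) ^ 2 * (2 * y / (1 + y ^ 2)) ^ 2) = q ^ 2 := by
    rw [hq]
    field_simp
    ring
  have hD : 0 < (1 + y ^ 2) * (1 - x ^ 2 * y ^ 2) / (1 + x ^ 2 * y ^ 2) ^ 2 *
      (2 * (1 - y ^ 2) / (1 + y ^ 2) ^ 2) := by
    exact mul_pos (div_pos (mul_pos h5 h2) (by positivity)) (div_pos (mul_pos two_pos h1) (by positivity))
  rw [mul_zero, sub_zero, hR, Real.sqrt_sq hq0.le, abs_of_pos hD, hq]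
  field_simp

/-! ## The change of variables `Ψ`: derivative, determinant, semialgebraicity -/

/-- `d/dt (2t/(1+t²)) = 2(1−t²)/(1+t²)²`. [folklore] -/
theorem hasDerivAt_halfAngleSine (t : ℝ) :
    HasDerivAt (fun s : ℝ => 2 * s / (1 + s ^ 2)) (2 * (1 - t ^ 2) / (1 + t ^ 2) ^ 2) t := by
  have hc : HasDerivAt (fun s : ℝ => 2 * s) 2 t := by
    simpa using (hasDerivAt_id t).const_mul 2
  have hd : HasDerivAt (fun s : ℝ => 1 + s ^ 2) (2 * t) t := by
    simpa using ((hasDerivAt_id t).pow 2).const_add 1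
  have h := hc.div hd (by positivity)
  have e : (2 * (1 + t ^ 2) - 2 * t * (2 * t)) / (1 + t ^ 2) ^ 2 = 2 * (1 - t ^ 2) / (1 + t ^ 2) ^ 2 := by
    ring
  rw [e] at h
  exact h

/-- **The derivative of `Ψ`**: the upper-triangular Jacobian
`!![(1+y²)(1−x²y²)/(1+x²y²)², 2xy(1−x²)/(1+x²y²)²; 0, 2(1−y²)/(1+y²)²]`. [folklore] -/
theorem hasFDerivAt_psi (z : Fin 2 → ℝ) :
    HasFDerivAt
      (fun w : Fin 2 → ℝ =>
        (![w 0 * (1 + w 1 ^ 2) / (1 + w 0 ^ 2 * w 1 ^ 2), 2 * w 1 / (1 + w 1 ^ 2)] : Fin 2 → ℝ))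
      (LinearMap.toContinuousLinearMap (Matrix.toLin'
        !![(1 + z 1 ^ 2) * (1 - z 0 ^ 2 * z 1 ^ 2) / (1 + z 0 ^ 2 * z 1 ^ 2) ^ 2,
            2 * z 0 * z 1 * (1 - z 0 ^ 2) / (1 + z 0 ^ 2 * z 1 ^ 2) ^ 2;
           0, 2 * (1 - z 1 ^ 2) / (1 + z 1 ^ 2) ^ 2])) z := by
  have hB0 : (1 : ℝ) + z 0 ^ 2 * z 1 ^ 2 ≠ 0 := by positivity
  have hB1 : (1 : ℝ) + z 1 ^ 2 ≠ 0 := by positivity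
  have p0 : HasFDerivAt (fun y : Fin 2 → ℝ => y 0)
      (ContinuousLinearMap.proj (R := ℝ) (φ := fun _ : Fin 2 => ℝ) 0) z := hasFDerivAt_apply 0 z
  have p1 : HasFDerivAt (fun y : Fin 2 → ℝ => y 1)
      (ContinuousLinearMap.proj (R := ℝ) (φ := fun _ : Fin 2 => ℝ) 1) z := hasFDerivAt_apply 1 z
  have hA := p0.mul ((p1.pow 2).const_add 1)
  have hB := ((p0.pow 2).mul (p1.pow 2)).const_add 1
  have hBinv := (hasDerivAt_inv hB0).comp_hasFDerivAt z hB
  have c0 : HasFDerivAt (fun y : Fin 2 → ℝ => y 0 * (1 + y 1 ^ 2) / (1 + y 0 ^ 2 * y 1 ^ 2))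
      ((ContinuousLinearMap.proj 0).comp (LinearMap.toContinuousLinearMap (Matrix.toLin'
        !![(1 + z 1 ^ 2) * (1 - z 0 ^ 2 * z 1 ^ 2) / (1 + z 0 ^ 2 * z 1 ^ 2) ^ 2,
            2 * z 0 * z 1 * (1 - z 0 ^ 2) / (1 + z 0 ^ 2 * z 1 ^ 2) ^ 2;
           0, 2 * (1 - z 1 ^ 2) / (1 + z 1 ^ 2) ^ 2]))) z := by
    refine (hA.mul hBinv).congr_fderiv ?_
    ext v
    simp [dotProduct, Fin.sum_univ_two, Function.comp]
    field_simp
    ring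
  have c1 : HasFDerivAt (fun y : Fin 2 → ℝ => 2 * y 1 / (1 + y 1 ^ 2))
      ((ContinuousLinearMap.proj 1).comp (LinearMap.toContinuousLinearMap (Matrix.toLin'
        !![(1 + z 1 ^ 2) * (1 - z 0 ^ 2 * z 1 ^ 2) / (1 + z 0 ^ 2 * z 1 ^ 2) ^ 2,
            2 * z 0 * z 1 * (1 - z 0 ^ 2) / (1 + z 0 ^ 2 * z 1 ^ 2) ^ 2;
           0, 2 * (1 - z 1 ^ 2) / (1 + z 1 ^ 2) ^ 2]))) z := by
    refine ((hasDerivAt_halfAngleSine (z 1)).comp_hasFDerivAt z p1).congr_fderiv ?_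
    ext v
    simp [dotProduct, Fin.sum_univ_two]
  rw [hasFDerivAt_pi']
  intro i
  fin_cases i
  · exact c0
  · exact c1

/-- The determinant of the Jacobian of `Ψ` (upper triangular). [folklore] -/
theorem det_psiDeriv (z : Fin 2 → ℝ) :
    (LinearMap.toContinuousLinearMap (Matrix.toLin'
        !![(1 + z 1 ^ 2) * (1 - z 0 ^ 2 * z 1 ^ 2) / (1 + z 0 ^ 2 * z 1 ^ 2) ^ 2,
            2 * z 0 * z 1 * (1 - z 0 ^ 2) / (1 + z 0 ^ 2 * z 1 ^ 2) ^ 2;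
           0, 2 * (1 - z 1 ^ 2) / (1 + z 1 ^ 2) ^ 2]) :
          (Fin 2 → ℝ) →L[ℝ] (Fin 2 → ℝ)).det =
      (1 + z 1 ^ 2) * (1 - z 0 ^ 2 * z 1 ^ 2) / (1 + z 0 ^ 2 * z 1 ^ 2) ^ 2 *
        (2 * (1 - z 1 ^ 2) / (1 + z 1 ^ 2) ^ 2) -
      2 * z 0 * z 1 * (1 - z 0 ^ 2) / (1 + z 0 ^ 2 * z 1 ^ 2) ^ 2 * 0 := by
  rw [← Matrix.det_fin_two_of]
  exact LinearMap.det_toLin' _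

/-- `Ψ` is a `ℚ`-semialgebraic map on any `ℚ`-semialgebraic set (its coordinates are quotients of
`ℚ`-polynomials with non-vanishing denominators). [cite: BochnakCosteRoy1998, §2.2] -/
theorem isSemialgebraicMapOn_psi {S : Set (Fin 2 → ℝ)} (hS : IsSemialgebraic ℚ S) :
    IsSemialgebraicMapOn ℚ S (fun w : Fin 2 → ℝ =>
      (![w 0 * (1 + w 1 ^ 2) / (1 + w 0 ^ 2 * w 1 ^ 2), 2 * w 1 / (1 + w 1 ^ 2)] : Fin 2 → ℝ)) := by
  refine IsSemialgebraicMapOn.of_forall hS fun j => ?_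
  fin_cases j
  · refine (isSemialgebraicFunOn_aeval_div_aeval hS (X 0 * (1 + X 1 ^ 2) : MvPolynomial (Fin 2) ℚ)
      (1 + X 0 ^ 2 * X 1 ^ 2) (fun z _ => ?_)).congr fun z _ => ?_
    · simp only [map_add, map_one, map_mul, map_pow, aeval_X]
      positivity
    · simp
  · refine (isSemialgebraicFunOn_aeval_div_aeval hS (C 2 * X 1 : MvPolynomial (Fin 2) ℚ)
      (1 + X 1 ^ 2) (fun z _ => ?_)).congr fun z _ => ?_
    · simp only [map_add, map_one, map_pow, aeval_X]
      positivity
    · simp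

/-! ## The item -/

/-- **Catalan's constant two ways** (item `CatalanTwoWays` of route `LiouvilleUnfolding`,
stmt-KontsevichZagierPeriods-2839): the representations `[(0,1)², 1/(1+x²y²)]` and
`[(0,1)², 1/(2√((1−y²)(1−x²y²)))]` (both of value Catalan's `G`) are KZ-equivalent — indeed
`[A] − [B]` is ONE change-of-variables move (Kontsevich–Zagier's rule (2)) along the rational
self-map `Ψ(x,y) = (x(1+y²)/(1+x²y²), 2y/(1+y²))` of the open unit square.
[cite: KontsevichZagier2001, §1.2 rule (2)] -/
theorem CatalanTwoWays_proof :
    Summit.KontsevichZagierPeriods.KontsevichZagierPeriods.Theses.LiouvilleUnfolding.CatalanTwoWays := by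
  intro r r' hrd hri hr'd hr'i
  refine KZ.changeOfVariablesRel_subset_relations
    ⟨2, r, r',
      fun w : Fin 2 → ℝ =>
        (![w 0 * (1 + w 1 ^ 2) / (1 + w 0 ^ 2 * w 1 ^ 2), 2 * w 1 / (1 + w 1 ^ 2)] : Fin 2 → ℝ),
      fun z : Fin 2 → ℝ => LinearMap.toContinuousLinearMap (Matrix.toLin'
        !![(1 + z 1 ^ 2) * (1 - z 0 ^ 2 * z 1 ^ 2) / (1 + z 0 ^ 2 * z 1 ^ 2) ^ 2,
            2 * z 0 * z 1 * (1 - z 0 ^ 2) / (1 + z 0 ^ 2 * z 1 ^ 2) ^ 2;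
           0, 2 * (1 - z 1 ^ 2) / (1 + z 1 ^ 2) ^ 2]),
      isSemialgebraicMapOn_psi r.isSemialgebraic_domain,
      fun z _ => (hasFDerivAt_psi z).hasFDerivWithinAt, ?_, ?_, ?_, rfl⟩
  · -- injectivity on the square
    intro z hz z' hz' h
    rw [hrd] at hz hz'
    obtain ⟨a0, a1, b0, b1⟩ := hz
    obtain ⟨a0', a1', -, b1'⟩ := hz'
    have h0 := congrFun h 0
    have h1 := congrFun h 1
    simp only [Matrix.cons_val_zero, Matrix.cons_val_one] at h0 h1
    obtain ⟨e0, e1⟩ := inj_aux a0 a1 b0 b1 a0' a1' b1' h0 h1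
    funext i
    fin_cases i
    · exact e0
    · exact e1
  · -- the image is the square
    rw [hr'd, hrd]
    apply Subset.antisymm
    · intro w hw
      obtain ⟨A0, A1, B0, B1⟩ := hw
      obtain ⟨x, y, hx, hx1, hy, hy1, ex, ey⟩ := surj_aux A0 A1 B0 B1
      refine ⟨![x, y], ⟨by simpa using hx, by simpa using hx1, by simpa using hy, by simpa using hy1⟩,
        ?_⟩
      funext i
      fin_cases i
      · simpa using ex
      · simpa using ey
    · rintro _ ⟨z, hz, rfl⟩
      obtain ⟨a0, a1, b0, b1⟩ := hz
      obtain ⟨m0, m1, m2, m3⟩ := maps_aux a0 a1 b0 b1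
      exact ⟨by simpa using m0, by simpa using m1, by simpa using m2, by simpa using m3⟩
  · -- the pull-back identity
    intro z hz
    have hz' := hz
    rw [hrd] at hz'
    obtain ⟨a0, a1, b0, b1⟩ := hz'
    obtain ⟨m0, m1, m2, m3⟩ := maps_aux a0 a1 b0 b1
    have hmem : (![z 0 * (1 + z 1 ^ 2) / (1 + z 0 ^ 2 * z 1 ^ 2), 2 * z 1 / (1 + z 1 ^ 2)] :
        Fin 2 → ℝ) ∈ r'.domain := by
      rw [hr'd]
      exact ⟨by simpa using m0, by simpa using m1, by simpa using m2, by simpa using m3⟩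
    rw [hri hz, hr'i hmem, det_psiDeriv]
    simp only [Matrix.cons_val_zero, Matrix.cons_val_one]
    exact jacobian_identity a0 a1 b0 b1

end Summit.KontsevichZagierPeriods.LiouvilleUnfolding.Catalan

end
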